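import Literature.NumberTheory.LFunctions.LagariasDifferencedXiSpacings
import Mathlib.Analysis.SpecialFunctions.Integrals.Basic
import HarnessLib

/-!
# The trivial spacing law from an AVERAGED phase-velocity estimate (support for Lagarias 2005, Thms 4.1/5.2)

LINE 1 — LABEL: RH-FREE real analysis (a counting lemma for the zero lattice of a monotone phase). bears_on:
LADDER-RH B-C/B-P (COLUMN 6, de Branges; cell rh-crit/dbl row «dbl:R14-La05T5.2(1)», consumer: the discharge of
`lagarias2005_thm_5_2_1`). WHAT THIS IS NOT: a statement about `ξ`, `L(s, χ)` or their zeros — the phase here is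
an abstract `C¹` function; nothing in this module bears on the truth of RH.

Proofs only (no definition, no named fact).

## What is proved, and why

J. C. Lagarias, *Zero spacing distributions for differenced L-functions*, Acta Arith. 120 (2005) 159–184 =
arXiv:math/0601653 [Lagarias2005], proves Theorem 4.1 (and, "in a manner similar", Theorem 5.2, p. 10) by the
phase-lattice argument: the critical zeros `γ_n` of `A_{h,θ}` / `B_{h,θ}` are the solutions of
`Ψ(γ) ≡ c (mod π)` for the continuous phase `Ψ` of `e^{iθ}ξ(½ + h + it)`, and
`π = Ψ(γ_{n+1}) − Ψ(γ_n) = ∫_{γ_n}^{γ_{n+1}} Ψ′` with `Ψ′(t) = ½ log(t/2π) + O(1/t) + Re ζ′/ζ(½ + h + it)`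
(arXiv pp. 8–9). The tree's `Lagarias2005Spacing.hasTrivialSpacingDistribution_of_phase`
(`LagariasDifferencedXiSpacingDistributionProofs.lean`) formalises this with the POINTWISE hypothesis
`|Ψ′(t) − ½ log|t|| ≤ η log|t|` (`|t| ≥ T₀(η)`, every `η > 0`), which at `|h| = ½` requires
`sup_t |L′/L(1 + it)| = o(log t)`. For Dirichlet `L`-functions the tree has no such sup bound (only the
classical zero-free region), but the conclusion — a COUNTING statement, "the proportion of zeros `|γ| ≤ T` with an
`ε`-bad normalised spacing among the next `k` tends to `0`" — only needs the velocity estimate ON AVERAGE: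

* `Lagarias2005AvgSpacing.hasTrivialSpacingDistribution_of_phase_of_integral_pos` — if `Ψ′ = v` is
  continuous and POSITIVE, and for every `η > 0`, `∫_{−T}^{T} |v(t) − ½ log|t|| dt ≤ η T log T` for `T ≥ T₀(η)`,
  then every `F` whose critical zero ordinates are `{t : sin Ψ(t) = 0}` has `HasTrivialSpacingDistribution F k`
  for all `k`. (No uniform lower bound `v ≥ c > 0` is asked: at `|h| = ½` for `L(s, χ)` none is available from
  the classical zero-free region; growth, surjectivity and the successor windows of `Ψ` all come from the
  integral hypothesis.)
* `Lagarias2005AvgSpacing.hasTrivialSpacingDistribution_of_phase_of_integral` — the same under `v ≥ c > 0`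
  (corollary; first landed form).

Proof: a zero `γ` with `|γ|` large and `∫_γ^{γ⁺} |v − ½ log| ≤ ε₁` has gap `γ⁺ − γ ≤ 2(π + ε₁)` and
`|δ(γ) − 1| < ε` (`π = ∫_γ^{γ⁺} v`; `spacing_near_one_of_integral_le`); the intervals `[γ, γ⁺]` of distinct zeros
are disjoint and the `k` successors of a zero `|γ| ≤ T` lie in `[−T, 2T]` once `Ψ(2T) − Ψ(T) ≥ kπ` (true for
large `T`: `∫_T^{2T} v ≥ ¼ T log T`), so the number of zeros `|γ| ≤ T` with an exceptional successor is
`≤ k ε₁⁻¹ ∫_{−4T}^{4T} |v − ½ log| + O(1) = o(T log T)`, while the number of zeros `|γ| ≤ T` is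
`(Ψ(T) − Ψ(−T))/π + O(1) ≥ (1 − o(1)) T log T/π`. The pointwise hypothesis of the tree's lemma implies the
averaged one, so this is a generalisation, not a variant road; it is the form consumed at `|h| = ½` for `L(s, χ)`
(mean value of `L′/L` on `σ = 1`, sibling `DirichletLFunctionLogDerivMeanValue.lean`).

## References

* [Lagarias2005] J. C. Lagarias, Acta Arith. 120 (2005) 159–184 = arXiv:math/0601653 — proof of Theorem 4.1
  (arXiv pp. 8–9; held text `paper:arxiv-math_0601653` p0008:L89–p0009), Theorem 5.2 (p. 10, p0010:L124–163).
-/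

noncomputable section

open Complex Set MeasureTheory Filter Topology intervalIntegral
open scoped Real

namespace Literature.NumberTheory.LFunctions

namespace Lagarias2005AvgSpacing

/-! ## 0. The velocity defect `|v − ½ log|t||` is locally integrable -/

/-- `∫_a^b |v − ½ log|t||` makes sense for continuous `v` (`log` is locally integrable). [folklore] -/
private theorem intervalIntegrable_half_log (a b : ℝ) :
    IntervalIntegrable (fun t : ℝ ↦ 1 / 2 * Real.log (|t|)) volume a b := by
  have e : (fun t : ℝ ↦ 1 / 2 * Real.log (|t|)) = fun t ↦ 1 / 2 * Real.log t := by
    funext t; rw [Real.log_abs]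
  rw [e]
  exact intervalIntegral.intervalIntegrable_log'.const_mul _

/-- The defect `t ↦ |v(t) − ½ log|t||` is interval integrable for continuous `v`. [folklore] -/
private theorem intervalIntegrable_defect {v : ℝ → ℝ} (hv : Continuous v) (a b : ℝ) :
    IntervalIntegrable (fun t : ℝ ↦ |v t - 1 / 2 * Real.log (|t|)|) volume a b :=
  ((hv.intervalIntegrable a b).sub (intervalIntegrable_half_log a b)).abs

/-- `∫_a^b ½ log|t| dt = ½ (b log b − a log a − b + a)` with Mathlib's `log` (`log(−x) = log x`). [folklore] -/
private theorem integral_half_log (a b : ℝ) :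
    ∫ t in a..b, 1 / 2 * Real.log (|t|) = 1 / 2 * (b * Real.log b - a * Real.log a - b + a) := by
  have e : (fun t : ℝ ↦ 1 / 2 * Real.log (|t|)) = fun t ↦ 1 / 2 * Real.log t := by
    funext t; rw [Real.log_abs]
  rw [e, intervalIntegral.integral_const_mul, integral_log]

/-! ## 1. The phase and its zero lattice `γ : ℤ → ℝ`, `Ψ(γ_m) = mπ` -/

section Phase

variable {Ψ v : ℝ → ℝ} (hΨ : ∀ t, HasDerivAt Ψ (v t) t) (hvpos : ∀ t, 0 < v t)
include hΨ hvpos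

/-- The phase is strictly increasing. [folklore] -/
private theorem phase_strictMono : StrictMono Ψ :=
  strictMono_of_deriv_pos fun t ↦ by rw [(hΨ t).deriv]; exact hvpos t

omit hvpos in
/-- The phase is continuous. [folklore] -/
private theorem phase_continuous : Continuous Ψ :=
  continuous_iff_continuousAt.2 fun t ↦ (hΨ t).continuousAt

omit hvpos in
/-- `Ψ(b) − Ψ(a) = ∫_a^b v` (fundamental theorem of calculus; `v` continuous). [folklore] -/
private theorem phase_sub_eq_integral (hv : Continuous v) (a b : ℝ) :
    Ψ b - Ψ a = ∫ t in a..b, v t :=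
  (integral_eq_sub_of_hasDerivAt (fun t _ ↦ hΨ t) (hv.intervalIntegrable a b)).symm

/-- The phase is onto `ℝ` as soon as it gains any prescribed amount over `[T, 2T]` and over `[−2T, −T]` for
large `T` (this growth comes from the averaged velocity estimate, see the main theorem). [folklore] -/
private theorem phase_surjective
    (hgrow : ∀ B : ℝ, ∃ T₀ : ℝ, 0 ≤ T₀ ∧ ∀ T : ℝ, T₀ ≤ T →
      B ≤ Ψ (2 * T) - Ψ T ∧ B ≤ Ψ (-T) - Ψ (-(2 * T))) :
    Function.Surjective Ψ := by
  have hcont := phase_continuous hΨ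
  have hmono := (phase_strictMono hΨ hvpos).monotone
  refine hcont.surjective ?_ ?_
  · refine tendsto_atTop_atTop_of_monotone hmono fun b ↦ ?_
    obtain ⟨T₀, hT₀, h⟩ := hgrow (b - Ψ 0)
    refine ⟨2 * T₀, ?_⟩
    have h1 := (h T₀ le_rfl).1
    have h2 : Ψ 0 ≤ Ψ T₀ := hmono hT₀
    linarith
  · refine tendsto_atBot_atBot_of_monotone hmono fun b ↦ ?_
    obtain ⟨T₀, hT₀, h⟩ := hgrow (Ψ 0 - b)
    refine ⟨-(2 * T₀), ?_⟩
    have h1 := (h T₀ le_rfl).2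
    have h2 : Ψ (-T₀) ≤ Ψ 0 := hmono (by linarith)
    linarith

/-- **One gap.** If `γ < γ⁺` are consecutive points of the lattice (`Ψ(γ⁺) = Ψ(γ) + π`), `|γ| ≥ T₁(ε)` and the
velocity defect has integral `∫_γ^{γ⁺} |v − ½ log|t|| ≤ ε₁(ε)`, then the gap is at most `2(π + ε₁)` and the
normalised spacing `(γ⁺ − γ)(1/2π) log(|γ|/2π)` is within `ε` of `1` — the computation `π = ∫_γ^{γ⁺} Ψ′` of the
printed proof, with the sup bound on `Ψ′ − ½ log t` replaced by its integral over the gap.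
[cite: Lagarias2005, Theorem 4.1, proof (arXiv pp. 8–9; held text p0008:L89–p0009)] -/
private theorem spacing_near_one_of_integral_le (hv : Continuous v) {ε : ℝ} (hε : 0 < ε) :
    ∃ ε₁ T₁ : ℝ, 0 < ε₁ ∧ 0 < T₁ ∧ ∀ γ γ' : ℝ, T₁ ≤ |γ| → γ < γ' → Ψ γ' = Ψ γ + π →
      (∫ t in γ..γ', |v t - 1 / 2 * Real.log (|t|)|) ≤ ε₁ →
      |(γ' - γ) * (1 / (2 * π)) * Real.log (|γ| / (2 * π)) - 1| < ε := by
  have hπ := Real.pi_pos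
  have hπ3 := Real.pi_gt_three
  have hlog2π : 0 < Real.log (2 * π) := Real.log_pos (by linarith)
  have hexp1 : Real.exp 1 < 3 := by have := Real.exp_one_lt_d9; norm_num at this; linarith
  set ε₁ : ℝ := ε / 2 with hε₁
  have hε₁0 : 0 < ε₁ := by positivity
  set G : ℝ := 2 * (π + ε₁) with hG
  have hG0 : 0 < G := by positivity
  set M : ℝ := 1 + (2 * π + ε) * (1 + Real.log (2 * π)) / ε with hM
  have hMpos : 0 < (2 * π + ε) * (1 + Real.log (2 * π)) / ε := by positivity
  have hM1 : 1 < M := by rw [hM]; linarith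
  refine ⟨ε₁, max (2 * G + 3) (Real.exp M), hε₁0, lt_max_of_lt_left (by linarith), ?_⟩
  intro γ γ' hγT hlt hΨ' hIle
  have hγ2G : 2 * G + 3 ≤ |γ| := le_trans (le_max_left _ _) hγT
  have hγM : Real.exp M ≤ |γ| := le_trans (le_max_right _ _) hγT
  have hγpos : 0 < |γ| := by linarith
  set L : ℝ := Real.log |γ| with hL
  have hLM : M ≤ L := by
    rw [hL, ← Real.log_exp M]
    exact Real.log_le_log (Real.exp_pos _) hγM
  have hL1 : 1 < L := lt_of_lt_of_le hM1 hLM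
  have hEi := intervalIntegrable_defect hv
  have hmono := phase_strictMono hΨ hvpos
  -- the gap `g = γ⁺ − γ ≤ G = 2(π + ε₁)`
  set g : ℝ := γ' - γ with hg
  have hg0 : 0 < g := by rw [hg]; linarith
  have hgG : g ≤ G := by
    by_contra hlt'
    push Not at hlt'
    set x : ℝ := γ + G with hx
    have hγx : γ < x := by rw [hx]; linarith
    have hxγ' : x < γ' := by rw [hx]; linarith
    have hup : Ψ x - Ψ γ < π := by
      have := hmono hxγ'; rw [hΨ'] at this; linarith
    have hlow : π ≤ Ψ x - Ψ γ := by
      rw [phase_sub_eq_integral hΨ hv γ x]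
      have hE_le : (∫ t in γ..x, |v t - 1 / 2 * Real.log (|t|)|) ≤ ε₁ :=
        (intervalIntegral.integral_mono_interval le_rfl hγx.le hxγ'.le
          (Filter.Eventually.of_forall fun t ↦ abs_nonneg _) (hEi γ γ')).trans hIle
      have hv_ge : ∀ t ∈ Set.Icc γ x, 1 / 2 - |v t - 1 / 2 * Real.log (|t|)| ≤ v t := by
        intro t ht
        have h1 : |γ| - G ≤ |t| := by
          have := abs_sub_abs_le_abs_sub γ t
          have h' : |γ - t| ≤ G := by rw [abs_le]; constructor <;> linarith [ht.1, ht.2]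
          linarith
        have hte : Real.exp 1 ≤ |t| := by linarith
        have hlog1 : 1 ≤ Real.log |t| := by
          rw [← Real.log_exp 1]; exact Real.log_le_log (Real.exp_pos 1) hte
        have := neg_abs_le (v t - 1 / 2 * Real.log |t|)
        linarith
      have hint_ge : (∫ t in γ..x, (1 / 2 - |v t - 1 / 2 * Real.log (|t|)|)) ≤ ∫ t in γ..x, v t :=
        intervalIntegral.integral_mono_on hγx.le (intervalIntegrable_const.sub (hEi γ x))
          (hv.intervalIntegrable _ _) hv_ge
      have hsplit2 : (∫ t in γ..x, (1 / 2 - |v t - 1 / 2 * Real.log (|t|)|)) =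
          (x - γ) * (1 / 2) - ∫ t in γ..x, |v t - 1 / 2 * Real.log (|t|)| := by
        rw [intervalIntegral.integral_sub intervalIntegrable_const (hEi γ x), intervalIntegral.integral_const,
          smul_eq_mul]
      have hxγ : x - γ = G := by rw [hx]; ring
      rw [hsplit2, hxγ] at hint_ge
      have : G * (1 / 2) = π + ε₁ := by rw [hG]; ring
      linarith
    linarith
  -- `|log|t| − L| ≤ 1` on the gap
  have hlogt : ∀ t ∈ Set.uIcc γ γ', |Real.log |t| - L| ≤ 1 := by
    intro t ht
    rw [Set.uIcc_of_le hlt.le] at ht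
    have h1 : |γ| - G ≤ |t| := by
      have := abs_sub_abs_le_abs_sub γ t
      have h' : |γ - t| ≤ G := by rw [abs_le]; constructor <;> linarith [ht.1, ht.2]
      linarith
    have h2 : |t| ≤ |γ| + G := by
      have := abs_sub_abs_le_abs_sub t γ
      have h' : |t - γ| ≤ G := by rw [abs_le]; constructor <;> linarith [ht.1, ht.2]
      linarith
    have htpos : 0 < |t| := by linarith
    have a1 : Real.log |t| - L ≤ (|t| - |γ|) / |γ| := by
      rw [hL, ← Real.log_div htpos.ne' hγpos.ne']
      have := Real.log_le_sub_one_of_pos (div_pos htpos hγpos)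
      rw [div_sub_one hγpos.ne'] at this
      exact this
    have a2 : L - Real.log |t| ≤ (|γ| - |t|) / |t| := by
      rw [hL, ← Real.log_div hγpos.ne' htpos.ne']
      have := Real.log_le_sub_one_of_pos (div_pos hγpos htpos)
      rw [div_sub_one htpos.ne'] at this
      exact this
    have a3 : (|t| - |γ|) / |γ| ≤ 1 := by rw [div_le_one hγpos]; linarith
    have a4 : (|γ| - |t|) / |t| ≤ 1 := by rw [div_le_one htpos]; linarith
    rw [abs_le]; constructor <;> linarith
  -- `π = ∫_γ^{γ⁺} v = ∫ ½ log|t| + ∫ (v − ½ log|t|)`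
  have hvi : IntervalIntegrable v volume γ γ' := hv.intervalIntegrable _ _
  have hlogi : IntervalIntegrable (fun t : ℝ ↦ 1 / 2 * Real.log (|t|)) volume γ γ' :=
    intervalIntegrable_half_log γ γ'
  have hEi' : IntervalIntegrable (fun t : ℝ ↦ v t - 1 / 2 * Real.log (|t|)) volume γ γ' := hvi.sub hlogi
  have hsplit : π = (∫ t in γ..γ', 1 / 2 * Real.log (|t|)) + ∫ t in γ..γ', (v t - 1 / 2 * Real.log (|t|)) := by
    have h1 : Ψ γ' - Ψ γ = ∫ t in γ..γ', v t := phase_sub_eq_integral hΨ hv γ γ'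
    rw [hΨ', add_sub_cancel_left] at h1
    rw [h1, ← intervalIntegral.integral_add hlogi hEi']
    refine intervalIntegral.integral_congr fun t _ ↦ ?_
    ring
  have hJ : |∫ t in γ..γ', (v t - 1 / 2 * Real.log (|t|))| ≤ ε₁ :=
    (intervalIntegral.abs_integral_le_integral_abs hlt.le).trans hIle
  have hK : |(∫ t in γ..γ', 1 / 2 * Real.log (|t|)) - g * (L / 2)| ≤ g / 2 := by
    have e1 : (∫ t in γ..γ', 1 / 2 * Real.log (|t|)) - g * (L / 2) =
        ∫ t in γ..γ', (1 / 2 * Real.log (|t|) - L / 2) := by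
      rw [intervalIntegral.integral_sub hlogi intervalIntegrable_const, intervalIntegral.integral_const,
        smul_eq_mul, hg]
    rw [e1]
    have h := intervalIntegral.norm_integral_le_of_norm_le_const (a := γ) (b := γ') (C := 1 / 2)
      (f := fun t : ℝ ↦ 1 / 2 * Real.log (|t|) - L / 2) (fun t ht ↦ by
        have h' := hlogt t (Set.uIoc_subset_uIcc ht)
        rw [Real.norm_eq_abs, show 1 / 2 * Real.log |t| - L / 2 = 1 / 2 * (Real.log |t| - L) by ring,
          abs_mul, abs_of_pos (by norm_num : (0:ℝ) < 1 / 2)]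
        linarith)
    rw [Real.norm_eq_abs, ← hg, abs_of_pos hg0] at h
    linarith
  -- `|g L − 2π| ≤ g + 2 ε₁`, hence `g ≤ (2π + 2ε₁)/(L − 1)`
  have hmain : |g * L - 2 * π| ≤ g + 2 * ε₁ := by
    have a := abs_le.1 hJ
    have b := abs_le.1 hK
    rw [abs_le]; constructor <;> linarith [hsplit]
  have hgle : g * (L - 1) ≤ 2 * π + 2 * ε₁ := by
    have := (abs_le.1 hmain).2
    linarith
  -- the normalised spacing
  have hδ : (γ' - γ) * (1 / (2 * π)) * Real.log (|γ| / (2 * π)) - 1 =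
      (g * (L - Real.log (2 * π)) - 2 * π) / (2 * π) := by
    rw [Real.log_div hγpos.ne' (by positivity), ← hL, ← hg]
    field_simp
  rw [hδ, abs_div, abs_of_pos (by positivity : (0:ℝ) < 2 * π), div_lt_iff₀ (by positivity)]
  have h1 : |g * (L - Real.log (2 * π)) - 2 * π| ≤ g * (1 + Real.log (2 * π)) + 2 * ε₁ := by
    have e : g * (L - Real.log (2 * π)) - 2 * π = (g * L - 2 * π) - g * Real.log (2 * π) := by ring
    rw [e]
    refine (abs_sub _ _).trans ?_
    rw [abs_of_pos (mul_pos hg0 hlog2π)]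
    linarith [hmain]
  have hL1' : 0 < L - 1 := by linarith
  have h2 : g * (1 + Real.log (2 * π)) ≤ ε := by
    have hg' : g ≤ (2 * π + 2 * ε₁) / (L - 1) := by rw [le_div_iff₀ hL1']; exact hgle
    have hMle : (2 * π + ε) * (1 + Real.log (2 * π)) / ε ≤ L - 1 := by rw [hM] at hLM; linarith
    have h3 : (2 * π + ε) * (1 + Real.log (2 * π)) ≤ (L - 1) * ε := by
      rwa [div_le_iff₀ hε] at hMle
    calc g * (1 + Real.log (2 * π))
        ≤ (2 * π + 2 * ε₁) / (L - 1) * (1 + Real.log (2 * π)) := by gcongr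
      _ = (2 * π + ε) * (1 + Real.log (2 * π)) / (L - 1) := by rw [hε₁]; ring
      _ ≤ ε := by rw [div_le_iff₀ hL1']; linarith
  calc |g * (L - Real.log (2 * π)) - 2 * π| ≤ g * (1 + Real.log (2 * π)) + 2 * ε₁ := h1
    _ ≤ ε + ε := by rw [hε₁]; linarith
    _ < ε * (2 * π) := by nlinarith

variable {γ : ℤ → ℝ} (hγ : ∀ m : ℤ, Ψ (γ m) = m * π)
include hγ

/-- `sin Ψ(t) = 0` exactly at the lattice points `γ_m`. [folklore] -/
private theorem sin_phase_eq_zero_iff (t : ℝ) : Real.sin (Ψ t) = 0 ↔ ∃ m : ℤ, t = γ m := by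
  constructor
  · intro h
    obtain ⟨m, hm⟩ := Real.sin_eq_zero_iff.1 h
    refine ⟨m, (phase_strictMono hΨ hvpos).injective ?_⟩
    rw [hγ m, hm]
  · rintro ⟨m, rfl⟩
    rw [hγ]
    exact Real.sin_eq_zero_iff.2 ⟨m, rfl⟩

/-- The lattice is strictly increasing. [folklore] -/
private theorem latt_strictMono : StrictMono γ := by
  intro m n hmn
  rw [← (phase_strictMono hΨ hvpos).lt_iff_lt, hγ, hγ]
  exact mul_lt_mul_of_pos_right (by exact_mod_cast hmn) Real.pi_pos

/-- **Successor window**: if `Ψ` gains at least `kπ` over `[T, 2T]`, the `j ≤ k` successors of a lattice point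
`|γ_m| ≤ T` lie in `[−T, 2T]`. [folklore] -/
private theorem abs_latt_add_nat_le {T : ℝ} (hT : 0 ≤ T) {k : ℕ} (hwin : (k : ℝ) * π ≤ Ψ (2 * T) - Ψ T)
    {m : ℤ} (hm : |γ m| ≤ T) {j : ℕ} (hj : j ≤ k) : |γ (m + j)| ≤ 2 * T := by
  have hmono := latt_strictMono hΨ hvpos hγ
  have hΨmono := (phase_strictMono hΨ hvpos)
  obtain ⟨hm1, hm2⟩ := abs_le.1 hm
  rw [abs_le]
  constructor
  · have : γ m ≤ γ (m + j) := hmono.monotone (by omega)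
    linarith
  · rw [← hΨmono.le_iff_le, hγ]
    have h1 : Ψ (γ m) ≤ Ψ T := hΨmono.monotone hm2
    rw [hγ] at h1
    have hjk : (j : ℝ) * π ≤ k * π := mul_le_mul_of_nonneg_right (by exact_mod_cast hj) Real.pi_pos.le
    push_cast
    nlinarith

/-- `|γ_m| ≤ T ⟺ Ψ(−T) ≤ mπ ≤ Ψ(T)`. [folklore] -/
private theorem abs_latt_le_iff (m : ℤ) (T : ℝ) : |γ m| ≤ T ↔ Ψ (-T) ≤ m * π ∧ (m : ℝ) * π ≤ Ψ T := by
  rw [abs_le, ← hγ m, (phase_strictMono hΨ hvpos).le_iff_le, (phase_strictMono hΨ hvpos).le_iff_le]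

/-- The indices with `|γ_m| ≤ T` form the integer interval `[⌈Ψ(−T)/π⌉, ⌊Ψ(T)/π⌋]`. [folklore] -/
private theorem setOf_abs_latt_le_eq (T : ℝ) :
    {m : ℤ | |γ m| ≤ T} = ↑(Finset.Icc ⌈Ψ (-T) / π⌉ ⌊Ψ T / π⌋) := by
  ext m
  simp only [mem_setOf_eq, abs_latt_le_iff hΨ hvpos hγ, Finset.coe_Icc, mem_Icc, Int.ceil_le,
    Int.le_floor, div_le_iff₀ Real.pi_pos, le_div_iff₀ Real.pi_pos]

/-- Finiteness of `{m : |γ_m| ≤ T}`. [folklore] -/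
private theorem finite_setOf_abs_latt_le (T : ℝ) : {m : ℤ | |γ m| ≤ T}.Finite := by
  rw [setOf_abs_latt_le_eq hΨ hvpos hγ]
  exact Finset.finite_toSet _

/-- Lattice count from below: `#{m : |γ_m| ≤ T} ≥ (Ψ(T) − Ψ(−T))/π − 1`. [folklore] -/
private theorem ncard_setOf_abs_latt_le_ge (T : ℝ) :
    (Ψ T - Ψ (-T)) / π - 1 ≤ (({m : ℤ | |γ m| ≤ T}.ncard : ℕ) : ℝ) := by
  rw [setOf_abs_latt_le_eq hΨ hvpos hγ, Set.ncard_coe_finset, Int.card_Icc]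
  set a' := Ψ (-T) / π
  set b' := Ψ T / π
  have h2 : (⌈a'⌉ : ℝ) < a' + 1 := Int.ceil_lt_add_one a'
  have h3 : b' < (⌊b'⌋ : ℝ) + 1 := Int.lt_floor_add_one b'
  have e : (Ψ T - Ψ (-T)) / π = b' - a' := by simp only [a', b']; ring
  rw [e]
  have hcast : ((⌊b'⌋ + 1 - ⌈a'⌉ : ℤ) : ℝ) ≤ (((⌊b'⌋ + 1 - ⌈a'⌉).toNat : ℕ) : ℝ) := by
    exact_mod_cast Int.self_le_toNat _
  push_cast at hcast
  linarith

variable {F : ℂ → ℂ} (hZ : ∀ t : ℝ, t ∈ critZeroOrdinates F ↔ Real.sin (Ψ t) = 0)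
include hZ

/-- The next critical zero after `γ_m` is `γ_{m+1}`. [folklore] -/
private theorem nextCritZero_latt (m : ℤ) : nextCritZero F (γ m) = γ (m + 1) := by
  rw [nextCritZero]
  apply IsLeast.csInf_eq
  refine ⟨⟨(hZ _).2 ((sin_phase_eq_zero_iff hΨ hvpos hγ _).2 ⟨m + 1, rfl⟩),
    latt_strictMono hΨ hvpos hγ (lt_add_one m)⟩, ?_⟩
  rintro u ⟨hu, hmu⟩
  obtain ⟨n, rfl⟩ := (sin_phase_eq_zero_iff hΨ hvpos hγ u).1 ((hZ u).1 hu)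
  have hmn : m < n := (latt_strictMono hΨ hvpos hγ).lt_iff_lt.1 hmu
  exact (latt_strictMono hΨ hvpos hγ).monotone (by omega)

/-- Iterating: `(next)^[j] γ_m = γ_{m+j}`. [folklore] -/
private theorem nextCritZero_iterate_latt (j : ℕ) (m : ℤ) : (nextCritZero F)^[j] (γ m) = γ (m + j) := by
  induction j generalizing m with
  | zero => simp
  | succ j ih =>
    rw [Function.iterate_succ_apply, nextCritZero_latt hΨ hvpos hγ hZ, ih]
    congr 1
    push_cast
    ring

/-- The normalised spacing at `γ_m`. [folklore] -/
private theorem normZeroSpacing_latt (m : ℤ) :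
    normZeroSpacing F (γ m) = (γ (m + 1) - γ m) * (1 / (2 * π)) * Real.log (|γ m| / (2 * π)) := by
  rw [normZeroSpacing, nextCritZero_latt hΨ hvpos hγ hZ]

/-- Sets of critical zero ordinates are images of index sets. [folklore] -/
private theorem ncard_setOf_critZero (P : ℝ → Prop) :
    {t : ℝ | t ∈ critZeroOrdinates F ∧ P t}.ncard = {m : ℤ | P (γ m)}.ncard := by
  have hset : {t : ℝ | t ∈ critZeroOrdinates F ∧ P t} = γ '' {m : ℤ | P (γ m)} := by
    ext t
    constructor
    · rintro ⟨ht, hP⟩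
      obtain ⟨m, rfl⟩ := (sin_phase_eq_zero_iff hΨ hvpos hγ t).1 ((hZ t).1 ht)
      exact ⟨m, hP, rfl⟩
    · rintro ⟨m, hP, rfl⟩
      exact ⟨(hZ _).2 ((sin_phase_eq_zero_iff hΨ hvpos hγ _).2 ⟨m, rfl⟩), hP⟩
  rw [hset, Set.ncard_image_of_injective _ (latt_strictMono hΨ hvpos hγ).injective]

omit hΨ hvpos hγ hZ in
/-- Summing over consecutive gaps: `Σ_{i<n} ∫_{γ_{a+i}}^{γ_{a+i+1}} f = ∫_{γ_a}^{γ_{a+n}} f`. [folklore] -/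
private theorem sum_integral_latt_gaps {f : ℝ → ℝ} (hf : ∀ a b : ℝ, IntervalIntegrable f volume a b)
    (a : ℤ) (n : ℕ) :
    ∑ i ∈ Finset.range n, ∫ t in γ (a + i)..γ (a + i + 1), f t = ∫ t in γ a..γ (a + n), f t := by
  have h := intervalIntegral.sum_integral_adjacent_intervals (μ := volume) (f := f)
    (a := fun i : ℕ ↦ γ (a + i)) (n := n) (fun k _ ↦ hf _ _)
  simp only [Nat.cast_zero, add_zero] at h
  rw [← h]
  refine Finset.sum_congr rfl fun i _ ↦ ?_
  rw [show a + ((i + 1 : ℕ) : ℤ) = a + i + 1 by push_cast; ring]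

omit hZ in
/-- **Markov step.** For a nonnegative locally integrable `E`, `ε₁ > 0` and `T' ≥ 0` with `Ψ(2T') − Ψ(T') ≥ π`,
the indices `m` with `|γ_m| ≤ T'` whose gap integral `∫_{γ_m}^{γ_{m+1}} E` exceeds `ε₁` number at most
`ε₁⁻¹ ∫_{−2T'}^{2T'} E`: the gaps are disjoint and lie in `[−T', 2T']`. [folklore] -/
private theorem eps_mul_ncard_gap_le {E : ℝ → ℝ} (hEi : ∀ a b : ℝ, IntervalIntegrable E volume a b)
    (hE0 : ∀ t, 0 ≤ E t) {ε₁ : ℝ} (hε₁ : 0 < ε₁) (T' : ℝ) (hT' : 0 ≤ T') (hwin : π ≤ Ψ (2 * T') - Ψ T') :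
    ε₁ * (({m : ℤ | |γ m| ≤ T' ∧ ε₁ < ∫ t in γ m..γ (m + 1), E t}.ncard : ℕ) : ℝ) ≤
      ∫ t in (-(2 * T'))..(2 * T'), E t := by
  have hπ := Real.pi_pos
  have hmono : StrictMono γ := latt_strictMono hΨ hvpos hγ
  have hΨmono := phase_strictMono hΨ hvpos
  set I : ℤ → ℝ := fun m ↦ ∫ t in γ m..γ (m + 1), E t with hI
  have hI0 : ∀ m, 0 ≤ I m := fun m ↦
    intervalIntegral.integral_nonneg (hmono (lt_add_one m)).le fun t _ ↦ hE0 t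
  set a : ℤ := ⌈Ψ (-T') / π⌉ with ha
  set b : ℤ := ⌊Ψ T' / π⌋ with hb
  set n : ℕ := (b + 1 - a).toNat with hn
  set S : Finset ℤ := (Finset.range n).image (fun i : ℕ ↦ a + i) with hS
  have hBS : {m : ℤ | |γ m| ≤ T' ∧ ε₁ < I m} ⊆ ↑(S.filter (fun m ↦ ε₁ < I m)) := by
    intro m ⟨hm, hIm⟩
    rw [Finset.coe_filter]
    refine ⟨?_, hIm⟩
    have hm' := (abs_latt_le_iff hΨ hvpos hγ m T').1 hm
    have ham : a ≤ m := by rw [ha, Int.ceil_le, div_le_iff₀ hπ]; exact hm'.1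
    have hmb : m ≤ b := by rw [hb, Int.le_floor, le_div_iff₀ hπ]; exact hm'.2
    rw [hS, Finset.mem_image]
    refine ⟨(m - a).toNat, Finset.mem_range.2 ?_, ?_⟩
    · rw [hn]; omega
    · rw [Int.toNat_of_nonneg (by omega)]; ring
  have hfin : (↑(S.filter (fun m ↦ ε₁ < I m)) : Set ℤ).Finite := Finset.finite_toSet _
  have h1 : (({m : ℤ | |γ m| ≤ T' ∧ ε₁ < I m}.ncard : ℕ) : ℝ) ≤ (S.filter (fun m ↦ ε₁ < I m)).card := by
    have := Set.ncard_le_ncard hBS hfin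
    rw [Set.ncard_coe_finset] at this
    exact_mod_cast this
  have h2 : ε₁ * ((S.filter (fun m ↦ ε₁ < I m)).card : ℝ) ≤ ∑ m ∈ S.filter (fun m ↦ ε₁ < I m), I m := by
    have := Finset.card_nsmul_le_sum (S.filter (fun m ↦ ε₁ < I m)) I ε₁
      (fun m hm ↦ (Finset.mem_filter.1 hm).2.le)
    rw [nsmul_eq_mul] at this
    linarith
  have h3 : ∑ m ∈ S.filter (fun m ↦ ε₁ < I m), I m ≤ ∑ m ∈ S, I m :=
    Finset.sum_le_sum_of_subset_of_nonneg (Finset.filter_subset _ _) fun m _ _ ↦ hI0 m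
  have h4 : ∑ m ∈ S, I m = ∫ t in γ a..γ (a + n), E t := by
    rw [hS, Finset.sum_image (fun i _ j _ h ↦ by exact_mod_cast (add_left_cancel h : (i : ℤ) = j))]
    exact sum_integral_latt_gaps hEi a n
  have hγa : -T' ≤ γ a := by
    rw [← hΨmono.le_iff_le, hγ]
    have : Ψ (-T') / π ≤ a := by rw [ha]; exact Int.le_ceil _
    rwa [div_le_iff₀ hπ] at this
  have hΨle : Ψ (-T') ≤ Ψ T' := hΨmono.monotone (by linarith)
  have hγan : γ (a + n) ≤ 2 * T' := by
    rcases Nat.eq_zero_or_pos n with hn0 | hnpos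
    · rw [hn0, Nat.cast_zero, add_zero]
      have h' : (a : ℝ) < Ψ (-T') / π + 1 := by rw [ha]; exact Int.ceil_lt_add_one _
      have h'' : ((a : ℝ) - 1) * π < Ψ (-T') := by
        have := sub_lt_iff_lt_add.2 h'
        rwa [lt_div_iff₀ hπ] at this
      have e : (a : ℝ) * π = ((a : ℝ) - 1) * π + π := by ring
      rw [← hΨmono.le_iff_le, hγ, e]
      linarith
    · have hab : a + n = b + 1 := by rw [hn]; omega
      rw [hab, ← hΨmono.le_iff_le, hγ]
      have : (b : ℝ) ≤ Ψ T' / π := by rw [hb]; exact Int.floor_le _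
      rw [le_div_iff₀ hπ] at this
      push_cast
      linarith
  have h5 : ∫ t in γ a..γ (a + n), E t ≤ ∫ t in (-(2 * T'))..(2 * T'), E t :=
    intervalIntegral.integral_mono_interval (by linarith) (hmono.monotone (by omega)) hγan
      (Filter.Eventually.of_forall fun t ↦ hE0 t) (hEi _ _)
  calc ε₁ * (({m : ℤ | |γ m| ≤ T' ∧ ε₁ < I m}.ncard : ℕ) : ℝ)
      ≤ ε₁ * ((S.filter (fun m ↦ ε₁ < I m)).card : ℝ) := mul_le_mul_of_nonneg_left h1 hε₁.le
    _ ≤ ∑ m ∈ S, I m := h2.trans h3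
    _ ≤ ∫ t in (-(2 * T'))..(2 * T'), E t := by rw [h4]; exact h5

omit hZ in
/-- **The exceptional indices.** If an `ε`-bad spacing at `γ_m` (`P m`) forces `|γ_m| < T₁` or a large gap
integral at `m` (`Q m`), and `Ψ` gains `kπ` over `[T, 2T]`, then the indices `|γ_m| ≤ T` with a bad spacing
among the next `k` number at most `k · (#{m : |γ_m| ≤ T₁} + #{m : |γ_m| ≤ 2T, Q m})`. [folklore] -/
private theorem ncard_bad_le {P Q : ℤ → Prop} {T₁ : ℝ} (hPQ : ∀ m, P m → |γ m| < T₁ ∨ Q m) (k : ℕ)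
    (T : ℝ) (hT : 0 ≤ T) (hwin : (k : ℝ) * π ≤ Ψ (2 * T) - Ψ T) :
    (({m : ℤ | |γ m| ≤ T ∧ ∃ j : ℕ, j < k ∧ P (m + j)}.ncard : ℕ) : ℝ) ≤
      k * ((({m : ℤ | |γ m| ≤ T₁}.ncard : ℕ) : ℝ) + (({m : ℤ | |γ m| ≤ 2 * T ∧ Q m}.ncard : ℕ) : ℝ)) := by
  classical
  set A : Set ℤ := {m : ℤ | |γ m| ≤ T₁} with hA
  set B : Set ℤ := {m : ℤ | |γ m| ≤ 2 * T ∧ Q m} with hBdef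
  have hAfin : A.Finite := finite_setOf_abs_latt_le hΨ hvpos hγ T₁
  have hBfin : B.Finite := (finite_setOf_abs_latt_le hΨ hvpos hγ (2 * T)).subset fun m hm ↦ hm.1
  have hABfin : (A ∪ B).Finite := hAfin.union hBfin
  set S : Finset ℤ := (Finset.range k).biUnion (fun j ↦ hABfin.toFinset.image (fun m ↦ m - (j : ℤ)))
    with hS
  have hsub : {m : ℤ | |γ m| ≤ T ∧ ∃ j : ℕ, j < k ∧ P (m + j)} ⊆ ↑S := by
    rintro m ⟨hm, j, hjk, hPj⟩
    rw [hS, Finset.coe_biUnion]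
    simp only [Finset.coe_range, Set.mem_iUnion, Set.mem_Iio, Finset.coe_image, Set.mem_image,
      Set.Finite.coe_toFinset]
    refine ⟨j, hjk, m + j, ?_, by ring⟩
    have hγmj : |γ (m + j)| ≤ 2 * T := abs_latt_add_nat_le hΨ hvpos hγ hT hwin hm hjk.le
    rcases hPQ (m + j) hPj with hlt | hQ
    · exact Or.inl hlt.le
    · exact Or.inr ⟨hγmj, hQ⟩
  have h1 := Set.ncard_le_ncard hsub (Finset.finite_toSet S)
  rw [Set.ncard_coe_finset] at h1
  have h2 : S.card ≤ k * hABfin.toFinset.card := by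
    calc S.card ≤ ∑ j ∈ Finset.range k, (hABfin.toFinset.image (fun m ↦ m - (j : ℤ))).card :=
          Finset.card_biUnion_le
      _ ≤ ∑ j ∈ Finset.range k, hABfin.toFinset.card := Finset.sum_le_sum fun j _ ↦ Finset.card_image_le
      _ = k * hABfin.toFinset.card := by rw [Finset.sum_const, Finset.card_range, smul_eq_mul]
  have h3 : hABfin.toFinset.card ≤ A.ncard + B.ncard := by
    rw [← Set.ncard_eq_toFinset_card (A ∪ B) hABfin]
    exact Set.ncard_union_le A B
  have h4 : ({m : ℤ | |γ m| ≤ T ∧ ∃ j : ℕ, j < k ∧ P (m + j)}.ncard : ℕ) ≤ k * (A.ncard + B.ncard) :=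
    h1.trans (h2.trans (Nat.mul_le_mul_left k h3))
  exact_mod_cast h4

omit hZ in
/-- **The total count.** `#{m : |γ_m| ≤ T} ≥ (T log T − T − ∫_{−T}^{T} |v − ½ log|t||)/π − 1` for `T ≥ 0`:
`Ψ(T) − Ψ(−T) = ∫_{−T}^{T} v ≥ ∫_{−T}^{T} ½ log|t| − ∫_{−T}^{T} |v − ½ log|t||` and `∫_{−T}^{T} ½ log|t| dt =
T log T − T`. [folklore] -/
private theorem count_ge_of_integral (hv : Continuous v) (T : ℝ) (hT : 0 ≤ T) :
    (T * Real.log T - T - ∫ t in (-T)..T, |v t - 1 / 2 * Real.log (|t|)|) / π - 1 ≤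
      (({m : ℤ | |γ m| ≤ T}.ncard : ℕ) : ℝ) := by
  have hπ := Real.pi_pos
  refine le_trans ?_ (ncard_setOf_abs_latt_le_ge hΨ hvpos hγ T)
  have hΨT : Ψ T - Ψ (-T) = ∫ t in (-T)..T, v t := phase_sub_eq_integral hΨ hv (-T) T
  have hlogi := intervalIntegrable_half_log (-T) T
  have hEi := intervalIntegrable_defect hv (-T) T
  have hlogint : ∫ t in (-T)..T, 1 / 2 * Real.log (|t|) = T * Real.log T - T := by
    rw [integral_half_log, Real.log_neg_eq_log]
    ring
  have hvge : (∫ t in (-T)..T, 1 / 2 * Real.log (|t|)) - (∫ t in (-T)..T, |v t - 1 / 2 * Real.log (|t|)|) ≤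
      ∫ t in (-T)..T, v t := by
    rw [← intervalIntegral.integral_sub hlogi hEi]
    refine intervalIntegral.integral_mono_on (by linarith) (hlogi.sub hEi) (hv.intervalIntegrable _ _)
      fun t _ ↦ ?_
    have := neg_abs_le (v t - 1 / 2 * Real.log |t|)
    linarith
  rw [hlogint] at hvge
  have : (T * Real.log T - T - ∫ t in (-T)..T, |v t - 1 / 2 * Real.log (|t|)|) / π ≤ (Ψ T - Ψ (-T)) / π := by
    rw [hΨT]
    exact div_le_div_of_nonneg_right hvge hπ.le
  linarith

end Phase

/-! ## 2. The averaged criterion -/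

/-- Growth of the phase over `[T, 2T]` and `[−2T, −T]` from the averaged velocity estimate: if
`∫_{−2T}^{2T} |v − ½ log|t|| ≤ ¼ T log T` (`T ≥ 2`), then `Ψ(2T) − Ψ(T) ≥ ¼ T log T` and
`Ψ(−T) − Ψ(−2T) ≥ ¼ T log T` (`∫_T^{2T} ½ log t dt ≥ ½ T log T`). [folklore] -/
private theorem phase_growth {Ψ v : ℝ → ℝ} (hΨ : ∀ t, HasDerivAt Ψ (v t) t) (hv : Continuous v) {T : ℝ}
    (hT : 2 ≤ T) (hint : (∫ t in (-(2 * T))..(2 * T), |v t - 1 / 2 * Real.log (|t|)|) ≤ 1 / 4 * (T * Real.log T)) :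
    1 / 4 * (T * Real.log T) ≤ Ψ (2 * T) - Ψ T ∧ 1 / 4 * (T * Real.log T) ≤ Ψ (-T) - Ψ (-(2 * T)) := by
  have hT0 : 0 < T := by linarith
  have hlog2 : 1 / 2 < Real.log 2 := by
    have := Real.log_two_gt_d9; linarith
  have hlogT : 0 ≤ Real.log T := Real.log_nonneg (by linarith)
  set E : ℝ → ℝ := fun t ↦ |v t - 1 / 2 * Real.log (|t|)| with hE
  have hEi := intervalIntegrable_defect hv
  have hE0 : ∀ t, 0 ≤ E t := fun t ↦ abs_nonneg _
  have hlogi := fun a b : ℝ ↦ intervalIntegrable_half_log a b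
  -- `∫_a^b v ≥ ∫_a^b ½ log|t| − ∫_a^b E`
  have hvge : ∀ a b : ℝ, a ≤ b →
      (∫ t in a..b, 1 / 2 * Real.log (|t|)) - (∫ t in a..b, E t) ≤ Ψ b - Ψ a := by
    intro a b hab
    rw [phase_sub_eq_integral hΨ hv a b, ← intervalIntegral.integral_sub (hlogi a b) (hEi a b)]
    refine intervalIntegral.integral_mono_on hab ((hlogi a b).sub (hEi a b)) (hv.intervalIntegrable _ _)
      fun t _ ↦ ?_
    have := neg_abs_le (v t - 1 / 2 * Real.log |t|)
    linarith
  have hlog2T : Real.log (2 * T) = Real.log 2 + Real.log T := Real.log_mul (by norm_num) hT0.ne'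
  -- the two `½ log` integrals
  have hI1 : 1 / 2 * (T * Real.log T) ≤ ∫ t in T..(2 * T), 1 / 2 * Real.log (|t|) := by
    rw [integral_half_log, hlog2T]
    nlinarith
  have hI2 : 1 / 2 * (T * Real.log T) ≤ ∫ t in (-(2 * T))..(-T), 1 / 2 * Real.log (|t|) := by
    rw [integral_half_log, Real.log_neg_eq_log, Real.log_neg_eq_log, hlog2T]
    nlinarith
  -- the two defect integrals are dominated by the full one
  have hE1 : (∫ t in T..(2 * T), E t) ≤ 1 / 4 * (T * Real.log T) :=
    (intervalIntegral.integral_mono_interval (by linarith) (by linarith) le_rfl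
      (Filter.Eventually.of_forall fun t ↦ hE0 t) (hEi _ _)).trans hint
  have hE2 : (∫ t in (-(2 * T))..(-T), E t) ≤ 1 / 4 * (T * Real.log T) :=
    (intervalIntegral.integral_mono_interval le_rfl (by linarith) (by linarith)
      (Filter.Eventually.of_forall fun t ↦ hE0 t) (hEi _ _)).trans hint
  constructor
  · have := hvge T (2 * T) (by linarith); linarith
  · have := hvge (-(2 * T)) (-T) (by linarith); linarith

/-- Elementary final estimate: with `N ≥ X/(4π)`, `Num ≤ k·NA + k·(8ηX)/ε₁`, `X ≥ 16πk·NA/δ` and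
`η ≤ δε₁/(128π(k+1))`, one has `Num < δ N`. [folklore] -/
private theorem ratio_lt_of_bounds {k : ℕ} {δ ε₁ η NA X N Num : ℝ} (hδ : 0 < δ) (hε₁ : 0 < ε₁)
    (hη : 0 < η) (hX : 0 < X) (hηδ : η ≤ δ * ε₁ / (128 * π * (k + 1)))
    (hXA : 16 * π * k * NA / δ ≤ X) (hN : X / (4 * π) ≤ N) (hNum : Num ≤ k * NA + k * (8 * η * X) / ε₁) :
    Num < δ * N := by
  have hπ := Real.pi_pos
  have hk0 : (0 : ℝ) ≤ k := Nat.cast_nonneg k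
  have hfirst : (k : ℝ) * NA ≤ δ / 4 * (X / (4 * π)) := by
    rw [div_le_iff₀ hδ] at hXA
    have e : δ / 4 * (X / (4 * π)) = X * δ / (16 * π) := by ring
    rw [e, le_div_iff₀ (by positivity)]
    linarith
  have hsecond : (k : ℝ) * (8 * η * X) / ε₁ ≤ δ / 4 * (X / (4 * π)) := by
    rw [div_le_iff₀ hε₁]
    have hη' : η * (128 * π * (k + 1)) ≤ δ * ε₁ := by rwa [le_div_iff₀ (by positivity)] at hηδ
    have e : δ / 4 * (X / (4 * π)) * ε₁ = δ * ε₁ * X / (16 * π) := by ring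
    rw [e, le_div_iff₀ (by positivity)]
    have e2 : (k : ℝ) * (8 * η * X) * (16 * π) = η * (128 * π * k) * X := by ring
    rw [e2]
    have h3 : η * (128 * π * k) ≤ η * (128 * π * (k + 1)) := by gcongr; linarith
    have h4 : η * (128 * π * k) ≤ δ * ε₁ := h3.trans hη'
    exact mul_le_mul_of_nonneg_right h4 hX.le
  have hXπ : 0 < X / (4 * π) := by positivity
  calc Num ≤ k * NA + k * (8 * η * X) / ε₁ := hNum
    _ ≤ δ / 4 * (X / (4 * π)) + δ / 4 * (X / (4 * π)) := add_le_add hfirst hsecond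
    _ = δ / 2 * (X / (4 * π)) := by ring
    _ < δ * (X / (4 * π)) := by nlinarith
    _ ≤ δ * N := mul_le_mul_of_nonneg_left hN hδ.le

set_option maxHeartbeats 400000 in
/-- **From an averaged phase-velocity estimate to the trivial spacing distribution (positive velocity).** Let
`Ψ` be a `C¹` phase with continuous, POSITIVE velocity `v = Ψ′` such that, for every `η > 0`,
`∫_{−T}^{T} |v(t) − ½ log|t|| dt ≤ η T log T` for all `T ≥ T₀(η)`. If the critical zero ordinates of `F` are
exactly the zeros of `sin Ψ`, then for every `k` the `k` consecutive normalised spacings of `F` have the trivial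
limiting distribution (`HasTrivialSpacingDistribution F k`). No uniform lower bound for `v` is assumed (at
`|h| = ½` for `L(s, χ)` none is available from the classical zero-free region): `Ψ → ±∞`, surjectivity and the
successor windows all follow from the integral hypothesis (`phase_growth`: `Ψ(2T) − Ψ(T) ≥ ¼ T log T`).
Proof: the zeros are a lattice `γ_m = Ψ⁻¹(mπ)`; a zero `γ_m` with `|γ_m| ≥ T₁(ε)` and
`∫_{γ_m}^{γ_{m+1}} |v − ½ log| ≤ ε₁(ε)` has `|δ(γ_m) − 1| < ε` (`spacing_near_one_of_integral_le`); summing over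
the disjoint gaps, at most `k ε₁⁻¹ ∫_{−4T}^{4T} |v − ½ log| + O(1) = o(T log T)` indices `|γ_m| ≤ T` have an
exceptional successor among the next `k`, against `#{m : |γ_m| ≤ T} ≥ (Ψ(T) − Ψ(−T))/π − 1 ≥ (1 − o(1)) T log T/π`.
[cite: Lagarias2005, Theorem 4.1, proof (arXiv pp. 8–9; held text p0008:L89–p0009); Theorem 5.2, proof (p. 10, p0010:L143–147)] -/
theorem hasTrivialSpacingDistribution_of_phase_of_integral_pos {Ψ v : ℝ → ℝ} (hΨ : ∀ t, HasDerivAt Ψ (v t) t)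
    (hv : Continuous v) (hvpos : ∀ t, 0 < v t)
    (hint : ∀ η : ℝ, 0 < η → ∃ T₀ : ℝ, ∀ T : ℝ, T₀ ≤ T →
      (∫ t in (-T)..T, |v t - 1 / 2 * Real.log (|t|)|) ≤ η * (T * Real.log T))
    {F : ℂ → ℂ} (hZ : ∀ t : ℝ, t ∈ critZeroOrdinates F ↔ Real.sin (Ψ t) = 0) (k : ℕ) :
    HasTrivialSpacingDistribution F k := by
  have hπ := Real.pi_pos
  have hπ3 := Real.pi_gt_three
  -- growth of the phase from the integral hypothesis (η = 1/16)
  obtain ⟨Tg, hTg⟩ := hint (1 / 16) (by norm_num)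
  have hgrow' : ∀ T : ℝ, max Tg 2 ≤ T →
      1 / 4 * (T * Real.log T) ≤ Ψ (2 * T) - Ψ T ∧ 1 / 4 * (T * Real.log T) ≤ Ψ (-T) - Ψ (-(2 * T)) := by
    intro T hT
    have hT2 : 2 ≤ T := le_trans (le_max_right _ _) hT
    have hTg' : Tg ≤ 2 * T := by linarith [le_max_left Tg 2]
    refine phase_growth hΨ hv hT2 ((hTg (2 * T) hTg').trans ?_)
    have hT0 : 0 < T := by linarith
    have hlog2T : Real.log (2 * T) = Real.log 2 + Real.log T := Real.log_mul (by norm_num) hT0.ne'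
    have hlog2 : Real.log 2 ≤ Real.log T := Real.log_le_log (by norm_num) hT2
    have hlogT : 0 ≤ Real.log T := Real.log_nonneg (by linarith)
    rw [hlog2T]
    nlinarith
  have hgrow : ∀ B : ℝ, ∃ T₀ : ℝ, 0 ≤ T₀ ∧ ∀ T : ℝ, T₀ ≤ T →
      B ≤ Ψ (2 * T) - Ψ T ∧ B ≤ Ψ (-T) - Ψ (-(2 * T)) := by
    intro B
    refine ⟨max (max Tg 2) (max (4 * B) 3), le_trans (by norm_num) ((le_max_right _ _).trans (le_max_right _ _)),
      fun T hT ↦ ?_⟩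
    have hT1 : max Tg 2 ≤ T := le_trans (le_max_left _ _) hT
    have hT3 : 3 ≤ T := le_trans ((le_max_right _ _).trans (le_max_right _ _)) hT
    have hTB : 4 * B ≤ T := le_trans ((le_max_left _ _).trans (le_max_right _ _)) hT
    obtain ⟨h1, h2⟩ := hgrow' T hT1
    have hlog1 : 1 ≤ Real.log T := by
      rw [← Real.log_exp 1]
      exact Real.log_le_log (Real.exp_pos 1) (by have := Real.exp_one_lt_d9; linarith)
    have hT0 : 0 ≤ T := by linarith
    have : B ≤ 1 / 4 * (T * Real.log T) := by nlinarith
    exact ⟨this.trans h1, this.trans h2⟩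
  -- the lattice of zeros
  choose γ hγ using fun m : ℤ ↦ phase_surjective hΨ hvpos hgrow ((m : ℝ) * π)
  have hmono : StrictMono γ := latt_strictMono hΨ hvpos hγ
  -- the velocity defect
  set E : ℝ → ℝ := fun t ↦ |v t - 1 / 2 * Real.log (|t|)| with hE
  have hEi : ∀ a b : ℝ, IntervalIntegrable E volume a b := intervalIntegrable_defect hv
  have hE0 : ∀ t, 0 ≤ E t := fun t ↦ abs_nonneg _
  intro ε hε
  obtain ⟨ε₁, T₁, hε₁, hT₁, hgap⟩ := spacing_near_one_of_integral_le hΨ hvpos hv hε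
  -- an `ε`-bad spacing at `γ_m` forces `|γ_m| < T₁` or a large gap integral
  have hbad : ∀ m : ℤ, ε ≤ |normZeroSpacing F (γ m) - 1| →
      |γ m| < T₁ ∨ ε₁ < ∫ t in γ m..γ (m + 1), E t := by
    intro m hm
    by_contra h
    push Not at h
    have hsucc : Ψ (γ (m + 1)) = Ψ (γ m) + π := by rw [hγ, hγ]; push_cast; ring
    have hlt := hgap (γ m) (γ (m + 1)) h.1 (hmono (lt_add_one m)) hsucc h.2
    rw [normZeroSpacing_latt hΨ hvpos hγ hZ] at hm
    exact absurd hlt (not_lt.2 hm)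
  -- numerator and denominator through the lattice
  have hnum : ∀ T : ℝ, ({t : ℝ | t ∈ critZeroOrdinates F ∧ |t| ≤ T ∧
      ∃ j : ℕ, j < k ∧ ε ≤ |normZeroSpacing F ((nextCritZero F)^[j] t) - 1|}.ncard : ℝ) =
      ({m : ℤ | |γ m| ≤ T ∧ ∃ j : ℕ, j < k ∧ ε ≤ |normZeroSpacing F (γ (m + j)) - 1|}.ncard : ℝ) := by
    intro T
    have h := ncard_setOf_critZero hΨ hvpos hγ hZ
      (fun t ↦ |t| ≤ T ∧ ∃ j : ℕ, j < k ∧ ε ≤ |normZeroSpacing F ((nextCritZero F)^[j] t) - 1|)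
    simp only [nextCritZero_iterate_latt hΨ hvpos hγ hZ] at h
    exact_mod_cast h
  have hden : ∀ T : ℝ, ({t : ℝ | t ∈ critZeroOrdinates F ∧ |t| ≤ T}.ncard : ℝ) =
      ({m : ℤ | |γ m| ≤ T}.ncard : ℝ) := fun T ↦ by
    exact_mod_cast ncard_setOf_critZero hΨ hvpos hγ hZ (fun t ↦ |t| ≤ T)
  have hN := count_ge_of_integral hΨ hvpos hγ hv
  -- the limit
  rw [Metric.tendsto_atTop]
  intro δ hδ
  set NA : ℝ := (({m : ℤ | |γ m| ≤ T₁}.ncard : ℕ) : ℝ) with hNA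
  have hNA0 : 0 ≤ NA := by positivity
  set η : ℝ := min (1 / 2) (δ * ε₁ / (128 * π * (k + 1))) with hη
  have hη0 : 0 < η := lt_min (by norm_num) (by positivity)
  have hη12 : η ≤ 1 / 2 := min_le_left _ _
  have hηδ : η ≤ δ * ε₁ / (128 * π * (k + 1)) := min_le_right _ _
  obtain ⟨T₀, hT₀⟩ := hint η hη0
  obtain ⟨Tw, hTw0, hTw⟩ := hgrow ((k + 1 : ℝ) * π)
  refine ⟨max (max (max T₀ Tw) (max (max Tg 2) (Real.exp 8))) (16 * π * k * NA / δ + 1), fun T hT ↦ ?_⟩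
  have hTT₀ : T₀ ≤ T := le_trans (le_trans (le_trans (le_max_left _ _) (le_max_left _ _)) (le_max_left _ _)) hT
  have hTTw : Tw ≤ T := le_trans (le_trans (le_trans (le_max_right _ _) (le_max_left _ _)) (le_max_left _ _)) hT
  have hTTg : max Tg 2 ≤ T :=
    le_trans (le_trans (le_trans (le_max_left _ _) (le_max_right _ _)) (le_max_left _ _)) hT
  have hTe : Real.exp 8 ≤ T :=
    le_trans (le_trans (le_trans (le_max_right _ _) (le_max_right _ _)) (le_max_left _ _)) hT
  have hTA : 16 * π * k * NA / δ + 1 ≤ T := le_trans (le_max_right _ _) hT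
  have hT8 : 8 ≤ Real.log T := by
    rw [← Real.log_exp 8]; exact Real.log_le_log (Real.exp_pos _) hTe
  have h9 : (9 : ℝ) ≤ T := le_trans (by have := Real.add_one_le_exp (8:ℝ); linarith) hTe
  have hTpos : 0 < T := by linarith
  have hlogT0 : 0 ≤ Real.log T := by linarith
  have hTlogT : T ≤ T * Real.log T := by nlinarith
  -- windows: `Ψ(2T) − Ψ(T) ≥ kπ`, `Ψ(4T) − Ψ(2T) ≥ π`
  have hkπ : (0 : ℝ) ≤ k * π := by positivity
  have hwin1 : (k : ℝ) * π ≤ Ψ (2 * T) - Ψ T := by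
    have := (hTw T hTTw).1; nlinarith
  have hwin2 : π ≤ Ψ (2 * (2 * T)) - Ψ (2 * T) := by
    have := (hTw (2 * T) (by linarith)).1
    nlinarith
  -- denominator
  have hden' : T * Real.log T / (4 * π) ≤ (({m : ℤ | |γ m| ≤ T}.ncard : ℕ) : ℝ) := by
    refine le_trans ?_ (hN T hTpos.le)
    have h1 : (∫ t in (-T)..T, E t) ≤ 1 / 2 * (T * Real.log T) :=
      (hT₀ T hTT₀).trans (mul_le_mul_of_nonneg_right hη12 (by positivity))
    have hTπ : π ≤ T := by linarith [Real.pi_le_four]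
    have key : T * Real.log T / 4 ≤ T * Real.log T - T - (∫ t in (-T)..T, E t) - π := by nlinarith
    have e1 : T * Real.log T / (4 * π) = (T * Real.log T / 4) / π := by
      rw [div_div]
    have e2 : (T * Real.log T - T - ∫ t in (-T)..T, E t) / π - 1 =
        (T * Real.log T - T - (∫ t in (-T)..T, E t) - π) / π := by
      field_simp
    rw [e1, e2]
    exact div_le_div_of_nonneg_right key hπ.le
  -- numerator: `#Bad(T) ≤ k (NA + #B(2T))`, `ε₁ #B(2T) ≤ ∫_{−4T}^{4T} E ≤ η 4T log 4T ≤ 8 η T log T`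
  have hBad := ncard_bad_le hΨ hvpos hγ hbad k T hTpos.le hwin1
  have hB := eps_mul_ncard_gap_le hΨ hvpos hγ hEi hE0 hε₁ (2 * T) (by linarith) hwin2
  have hlog4T : Real.log (2 * (2 * T)) ≤ 2 * Real.log T := by
    have e : 2 * (2 * T) = 4 * T := by ring
    rw [e, Real.log_mul (by norm_num) hTpos.ne']
    have hlog4 : Real.log 4 ≤ Real.log T := Real.log_le_log (by norm_num) (by linarith)
    linarith
  have hI4 : (∫ t in (-(2 * (2 * T)))..(2 * (2 * T)), E t) ≤ 8 * η * (T * Real.log T) := by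
    have h0 : T₀ ≤ 2 * (2 * T) := by linarith
    refine (hT₀ (2 * (2 * T)) h0).trans ?_
    have h2 : 2 * (2 * T) * Real.log (2 * (2 * T)) ≤ 4 * T * (2 * Real.log T) := by
      have : (0:ℝ) ≤ 2 * (2 * T) := by linarith
      nlinarith [hlog4T]
    nlinarith [h2, hη0.le]
  have hnum' : (({m : ℤ | |γ m| ≤ T ∧ ∃ j : ℕ, j < k ∧ ε ≤ |normZeroSpacing F (γ (m + j)) - 1|}.ncard : ℕ) : ℝ)
      ≤ k * NA + k * (8 * η * (T * Real.log T)) / ε₁ := by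
    refine hBad.trans ?_
    have h1 : (({m : ℤ | |γ m| ≤ 2 * T ∧ ε₁ < ∫ t in γ m..γ (m + 1), E t}.ncard : ℕ) : ℝ) ≤
        8 * η * (T * Real.log T) / ε₁ := by
      rw [le_div_iff₀ hε₁]
      linarith
    have hk0 : (0 : ℝ) ≤ k := Nat.cast_nonneg k
    calc (k : ℝ) * (NA + (({m : ℤ | |γ m| ≤ 2 * T ∧ ε₁ < ∫ t in γ m..γ (m + 1), E t}.ncard : ℕ) : ℝ))
        ≤ k * (NA + 8 * η * (T * Real.log T) / ε₁) := by gcongr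
      _ = k * NA + k * (8 * η * (T * Real.log T)) / ε₁ := by ring
  -- conclude
  rw [Real.dist_eq, sub_zero, hnum T, hden T]
  have hDpos : 0 < (({m : ℤ | |γ m| ≤ T}.ncard : ℕ) : ℝ) := lt_of_lt_of_le (by positivity) hden'
  rw [abs_of_nonneg (by positivity), div_lt_iff₀ hDpos]
  exact ratio_lt_of_bounds hδ hε₁ hη0 (by positivity) hηδ (by linarith) hden' hnum'

/-- **From an averaged phase-velocity estimate to the trivial spacing distribution** (velocity bounded below;
the first landed form, now a corollary of `hasTrivialSpacingDistribution_of_phase_of_integral_pos`). Let `Ψ` be a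
`C¹` phase with continuous velocity `v = Ψ′ ≥ c > 0` such that, for every `η > 0`,
`∫_{−T}^{T} |v(t) − ½ log|t|| dt ≤ η T log T` for all `T ≥ T₀(η)`. If the critical zero ordinates of `F` are
exactly the zeros of `sin Ψ`, then for every `k` the `k` consecutive normalised spacings of `F` have the trivial
limiting distribution (`HasTrivialSpacingDistribution F k`). This contains the pointwise criterion of the
tree (`Lagarias2005Spacing.hasTrivialSpacingDistribution_of_phase`: `|v − ½ log|t|| ≤ η log|t|` for
`|t| ≥ T₀(η)` gives the integral bound).
[cite: Lagarias2005, Theorem 4.1, proof (arXiv pp. 8–9; held text p0008:L89–p0009); Theorem 5.2, proof (p. 10, p0010:L143–147)] -/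
theorem hasTrivialSpacingDistribution_of_phase_of_integral {Ψ v : ℝ → ℝ} (hΨ : ∀ t, HasDerivAt Ψ (v t) t)
    (hv : Continuous v) {c : ℝ} (hc : 0 < c) (hcv : ∀ t, c ≤ v t)
    (hint : ∀ η : ℝ, 0 < η → ∃ T₀ : ℝ, ∀ T : ℝ, T₀ ≤ T →
      (∫ t in (-T)..T, |v t - 1 / 2 * Real.log (|t|)|) ≤ η * (T * Real.log T))
    {F : ℂ → ℂ} (hZ : ∀ t : ℝ, t ∈ critZeroOrdinates F ↔ Real.sin (Ψ t) = 0) (k : ℕ) :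
    HasTrivialSpacingDistribution F k :=
  hasTrivialSpacingDistribution_of_phase_of_integral_pos hΨ hv (fun t ↦ lt_of_lt_of_le hc (hcv t)) hint hZ k

/-- **Glue form** (the shape delivered by a velocity formula plus an `L¹` bound). Let `Ψ` be a `C¹` phase
with continuous positive velocity `v`, and `e` a continuous function with `|v(t) − ½ log|t| − e(t)| ≤ C₀` for
`|t| ≥ 1` (e.g. `v(t) = Re ξ′/ξ(½ + h + it, χ)`, `e(t) = Re L′/L(½ + h + it, χ)`, `C₀` from Stirling) and
`∫_{−T}^{T} |e| ≤ C·T` for `T ≥ T₀` (e.g. the mean value of `L′/L` on `σ = 1`,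
`DirichletLogDerivMeanValue.exists_integral_norm_logDeriv_one_le`, or boundedness of `L′/L` on `σ > 1`).
Then `∫_{−T}^{T} |v − ½ log|t|| = O(T) = o(T log T)`, so every `F` whose critical zero ordinates are the zeros
of `sin Ψ` has the trivial `k`-spacing distribution.
[cite: Lagarias2005, Theorem 4.1, proof (arXiv pp. 8–9); Theorem 5.2, proof (p. 10, p0010:L143–175)] -/
theorem hasTrivialSpacingDistribution_of_phase_of_defect_bound {Ψ v e : ℝ → ℝ}
    (hΨ : ∀ t, HasDerivAt Ψ (v t) t) (hv : Continuous v) (he : Continuous e) (hvpos : ∀ t, 0 < v t)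
    {C₀ : ℝ} (hve : ∀ t : ℝ, 1 ≤ |t| → |v t - 1 / 2 * Real.log (|t|) - e t| ≤ C₀)
    (hinte : ∃ C T₀ : ℝ, ∀ T : ℝ, T₀ ≤ T → (∫ t in (-T)..T, |e t|) ≤ C * T)
    {F : ℂ → ℂ} (hZ : ∀ t : ℝ, t ∈ critZeroOrdinates F ↔ Real.sin (Ψ t) = 0) (k : ℕ) :
    HasTrivialSpacingDistribution F k := by
  refine hasTrivialSpacingDistribution_of_phase_of_integral_pos hΨ hv hvpos ?_ hZ k
  obtain ⟨C, T₀, hC⟩ := hinte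
  -- the defect against `e`, `D(t) = |v − ½ log|t| − e|`, and its integral over `[−1, 1]`
  set D : ℝ → ℝ := fun t ↦ |v t - 1 / 2 * Real.log (|t|) - e t| with hD
  have hDi : ∀ a b : ℝ, IntervalIntegrable D volume a b := fun a b ↦
    (((hv.intervalIntegrable a b).sub (intervalIntegrable_half_log a b)).sub (he.intervalIntegrable a b)).abs
  have hD0 : ∀ t, 0 ≤ D t := fun t ↦ abs_nonneg _
  have hC₀ : 0 ≤ C₀ := le_trans (abs_nonneg _) (hve 1 (by norm_num))
  set K : ℝ := ∫ t in (-1:ℝ)..1, D t with hK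
  have hK0 : 0 ≤ K := intervalIntegral.integral_nonneg (by norm_num) fun t _ ↦ hD0 t
  have hei : ∀ a b : ℝ, IntervalIntegrable (fun t ↦ |e t|) volume a b := fun a b ↦
    (he.intervalIntegrable a b).abs
  -- `∫_{−T}^{T} D ≤ 2 C₀ T + K` for `T ≥ 1`
  have hDint : ∀ T : ℝ, 1 ≤ T → (∫ t in (-T)..T, D t) ≤ 2 * C₀ * T + K := by
    intro T hT
    have hout : ∀ a b : ℝ, a ≤ b → (∀ t ∈ Set.Ioc a b, 1 ≤ |t|) → (∫ t in a..b, D t) ≤ C₀ * (b - a) := by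
      intro a b hab hmem
      have h := intervalIntegral.norm_integral_le_of_norm_le_const (a := a) (b := b) (C := C₀) (f := D)
        (fun t ht ↦ by
          rw [Set.uIoc_of_le hab] at ht
          rw [Real.norm_eq_abs, abs_of_nonneg (hD0 t)]
          exact hve t (hmem t ht))
      have hba : |b - a| = b - a := abs_of_nonneg (sub_nonneg.2 hab)
      rw [hba] at h
      exact (Real.le_norm_self _).trans h
    have h1 : (∫ t in (-T)..(-1), D t) ≤ C₀ * (-1 - -T) :=
      hout (-T) (-1) (by linarith) fun t ht ↦ by
        have : t ≤ -1 := ht.2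
        rw [abs_of_neg (by linarith)]; linarith
    have h3 : (∫ t in (1:ℝ)..T, D t) ≤ C₀ * (T - 1) :=
      hout 1 T hT fun t ht ↦ by
        have : 1 < t := ht.1
        rw [abs_of_pos (by linarith)]; linarith
    have hsplit : (∫ t in (-T)..T, D t) =
        (∫ t in (-T)..(-1), D t) + (∫ t in (-1:ℝ)..1, D t) + ∫ t in (1:ℝ)..T, D t := by
      rw [intervalIntegral.integral_add_adjacent_intervals (hDi _ _) (hDi _ _),
        intervalIntegral.integral_add_adjacent_intervals (hDi _ _) (hDi _ _)]
    rw [hsplit, ← hK]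
    nlinarith
  -- the `hint` binder
  intro η hη
  set A : ℝ := 2 * C₀ + |C| + K + 1 with hA
  have hA0 : 0 < A := by have := abs_nonneg C; linarith
  refine ⟨max (max T₀ 1) (Real.exp (A / η)), fun T hT ↦ ?_⟩
  have hT₀ : T₀ ≤ T := le_trans ((le_max_left _ _).trans (le_max_left _ _)) hT
  have hT1 : 1 ≤ T := le_trans ((le_max_right _ _).trans (le_max_left _ _)) hT
  have hTe : Real.exp (A / η) ≤ T := le_trans (le_max_right _ _) hT
  have hT0 : 0 < T := by linarith
  have hlog : A / η ≤ Real.log T := by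
    rw [← Real.log_exp (A / η)]; exact Real.log_le_log (Real.exp_pos _) hTe
  have hlog' : A ≤ η * Real.log T := by rwa [div_le_iff₀' hη] at hlog
  -- pointwise `|v − ½ log| ≤ D + |e|`
  have hpt : ∀ t ∈ Set.Icc (-T) T, |v t - 1 / 2 * Real.log (|t|)| ≤ D t + |e t| := by
    intro t _
    have := abs_sub_abs_le_abs_sub (v t - 1 / 2 * Real.log (|t|)) (e t)
    simp only [hD]
    linarith
  have hmono : (∫ t in (-T)..T, |v t - 1 / 2 * Real.log (|t|)|) ≤ ∫ t in (-T)..T, (D t + |e t|) :=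
    intervalIntegral.integral_mono_on (by linarith) (intervalIntegrable_defect hv _ _)
      ((hDi _ _).add (hei _ _)) hpt
  rw [intervalIntegral.integral_add (hDi _ _) (hei _ _)] at hmono
  have h1 := hDint T hT1
  have h2 := hC T hT₀
  have h3 : C * T ≤ |C| * T := mul_le_mul_of_nonneg_right (le_abs_self C) hT0.le
  have h4 : K ≤ K * T := le_mul_of_one_le_right hK0 hT1
  calc (∫ t in (-T)..T, |v t - 1 / 2 * Real.log (|t|)|)
      ≤ (∫ t in (-T)..T, D t) + ∫ t in (-T)..T, |e t| := hmono
    _ ≤ 2 * C₀ * T + K + C * T := by linarith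
    _ ≤ A * T := by rw [hA]; nlinarith
    _ ≤ η * Real.log T * T := mul_le_mul_of_nonneg_right hlog' hT0.le
    _ = η * (T * Real.log T) := by ring

end Lagarias2005AvgSpacing

end Literature.NumberTheory.LFunctions
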